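import Literature.Probability.RandomPlanarGeometry.LoewnerImageDriverStep
import Literature.Probability.RandomPlanarGeometry.StarHullOneStepCompensated
import HarnessLib

/-!
# The tilted martingale identities (line `boundary-area-law`, RS5b′/T2): one-step algebra and envelopes

Line `boundary-area-law` of the crux `SubseqIdentification` (stmt-CriticalPhenomena-0783), restriction
reshape (lead c4), stub `stub_tiltedMartingales` = step (T2) of the tilted [LSW] Theorem 6.5
(G. F. Lawler, O. Schramm, W. Werner, *Conformal restriction: the chordal case*, J. Amer. Math. Soc.
**16** (2003), §5 (5.1)–(5.3) and Prop. 5.3): the products `Mⁿ · Y` and `((Mⁿ)² − κ cⁿ) · Y` of the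
localised image driving function `Mⁿ = h_t(W_t)` with the compensated restriction martingale
`Y = h_t′(W_t)^α e^{−λ∫m}` are martingales, because `d⟨W̃, Y⟩ = Y α κ h″ dt` cancels the drift
`Y (κ/2 − 3) h″ dt` of `Y dW̃` (`κα + κ/2 − 3 = 0` for `α = (6 − κ)/(2κ)`).

This first helper file is the deterministic ONE-STEP ALGEBRA of the mixed term (sub-step T2b of
`RS5b-PLAN.md`), in the real-variable format of `StarHullOneStepKappa` / `LoewnerImageDriverStep`:

* `exists_abs_stepModelK_sub_linear_le` — the model of `ΔY` minus its linear part `α d^{α−1} c₂ x` is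
  `O(x² + u)` uniformly on the controlled class;
* `exists_abs_prod_sub_model_le` — **the product expansion**: if `|ΔW̃ − (d x + c₂x²/2 − 3c₂u)| ≤ K₁ r` and
  `|Ŷ′ − d^α − (stepModelK − λ u m d^α)| ≤ K₂ r` (`r ≥ u², |x|³, u|x|`), then
  `ΔW̃ · Ŷ′ − 6α d^α c₂ u` is `imageDriverModel (d^{α+1}) (d^α c₂ (1 + 2α)) u x + O(r)`: the
  product of the two one-step models is `d^α (d x + c₂ x²/2 − 3 c₂ u) + α d^α c₂ x²` up to `O(r)`, and
  this is again an image-driver model up to the constant `6α d^α c₂ u`, so the abstract one-step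
  estimates `abs_integral_sub_drift_le` / `abs_integral_sq_sub_le` of `SLEImageDriverOneStep(Variance)`
  apply verbatim to the product (no definition is introduced: the constants are existential, uniform on
  the class). With the SLE_κ increment (`E x² = κ u`) the product model has mean
  `u d^α c₂ (κ/2 − 3 + κα)`, which vanishes exactly for `α = (6 − κ)/(2κ)`.

References: [LSW] §5 (5.1)–(5.3), Prop. 5.3. No named fact is used.
-/

noncomputable section

open Set Function
open scoped NNReal
open Literature.Probability.RandomPlanarGeometry

namespace Summit.CriticalPhenomena.SAWScalingLimit.Theorems.SubseqIdentification.BoundaryAreaLaw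

open Loewner

/-! ### The model of `ΔY` minus its linear part -/

section Model

/-- **The model of `ΔY` minus its linear part is `O(x² + u)`, uniformly on the controlled class**:
there is `K_Q = K_Q(α, δ₀, ρ₀) ≥ 0` with `|stepModelK α d c₂ c₃ u x − α d^{α−1} c₂ x| ≤ K_Q · (x² + u)` and
`|α d^{α−1} c₂| ≤ modelKA1 α δ₀ ρ₀`, for all `δ₀ ≤ d ≤ 1`, `|c₂| ≤ 1/ρ₀`, `|c₃| ≤ 2/ρ₀²`, `x`, `u`. [folklore] -/
theorem exists_abs_stepModelK_sub_linear_le {α δ₀ ρ₀ : ℝ} (hα : 0 < α) (hδ0 : 0 < δ₀) (hρ₀ : 0 < ρ₀) :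
    ∃ KQ : ℝ, 0 ≤ KQ ∧ ∀ {d c₂ c₃ : ℝ} {u : ℝ≥0} (x : ℝ), δ₀ ≤ d → d ≤ 1 → |c₂| ≤ 1 / ρ₀ → |c₃| ≤ 2 / ρ₀ ^ 2 →
      |stepModelK α d c₂ c₃ u x - α * d ^ (α - 1) * c₂ * x| ≤ KQ * (x ^ 2 + u) ∧
        |α * d ^ (α - 1) * c₂| ≤ modelKA1 α δ₀ ρ₀ := by
  have hL0 : 0 ≤ ratioK α δ₀ := ratioK_nonneg hα.le hδ0
  have hq1 : 0 ≤ δ₀ ^ (-(3 / 8 : ℝ)) := Real.rpow_nonneg hδ0.le _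
  have hq2 : 0 ≤ δ₀ ^ (-(11 / 8 : ℝ)) := Real.rpow_nonneg hδ0.le _
  refine ⟨ratioK α δ₀ * (5 / 8 * δ₀ ^ (-(3 / 8 : ℝ))) * (1 / ρ₀ ^ 2 + (1 / (2 * δ₀ * ρ₀ ^ 2) + 8 / (3 * ρ₀ ^ 2))) +
    ratioK α δ₀ * (15 / 128 * δ₀ ^ (-(11 / 8 : ℝ))) * (1 / ρ₀ ^ 2), by positivity, ?_⟩
  intro d c₂ c₃ u x hδ hd1 hc2 hc3
  have hd0 : 0 < d := hδ0.trans_le hδ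
  have hu0 : (0 : ℝ) ≤ u := u.coe_nonneg
  obtain ⟨-, r2, r3⟩ := ratioK_spec hα hδ0 hδ hd1
  have hT2 : d ^ (-(3 / 8 : ℝ)) ≤ δ₀ ^ (-(3 / 8 : ℝ)) := Real.rpow_le_rpow_of_nonpos hδ0 hδ (by norm_num)
  have hT3 : d ^ (-(11 / 8 : ℝ)) ≤ δ₀ ^ (-(11 / 8 : ℝ)) := Real.rpow_le_rpow_of_nonpos hδ0 hδ (by norm_num)
  set P := ratioK α δ₀ * (5 / 8 * δ₀ ^ (-(3 / 8 : ℝ))) with hP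
  set Q := ratioK α δ₀ * (15 / 128 * δ₀ ^ (-(11 / 8 : ℝ))) with hQ
  have hp1 : α * d ^ (α - 1) ≤ P := r2.trans (mul_le_mul_of_nonneg_left (mul_le_mul_of_nonneg_left hT2 (by norm_num)) hL0)
  have hp2 : |α * (α - 1)| * d ^ (α - 2) / 2 ≤ Q :=
    r3.trans (mul_le_mul_of_nonneg_left (mul_le_mul_of_nonneg_left hT3 (by norm_num)) hL0)
  have hp10 : 0 ≤ α * d ^ (α - 1) := mul_nonneg hα.le (Real.rpow_nonneg hd0.le _)
  have hp20 : 0 ≤ |α * (α - 1)| * d ^ (α - 2) / 2 := by have := Real.rpow_nonneg hd0.le (α - 2); positivity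
  have hP0 : 0 ≤ P := hp10.trans hp1
  have hQ0 : 0 ≤ Q := hp20.trans hp2
  have hc20 : 0 ≤ |c₂| := abs_nonneg _
  have hρ2 : 0 < ρ₀ ^ 2 := by positivity
  -- coefficient sizes
  have hc2sq : c₂ ^ 2 ≤ 1 / ρ₀ ^ 2 := by
    rw [← sq_abs, show 1 / ρ₀ ^ 2 = (1 / ρ₀) ^ 2 by ring]; exact pow_le_pow_left₀ hc20 hc2 2
  have hinvd : 1 / d ≤ 1 / δ₀ := one_div_le_one_div_of_le hδ0 hδ
  have hk1 : |c₂ ^ 2 / (2 * d)| ≤ 1 / (2 * δ₀ * ρ₀ ^ 2) := by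
    rw [abs_div, abs_of_nonneg (sq_nonneg _), abs_of_pos (by positivity : (0 : ℝ) < 2 * d)]
    rw [div_le_div_iff₀ (by positivity) (by positivity)]
    have : c₂ ^ 2 * δ₀ ≤ 1 / ρ₀ ^ 2 * d := mul_le_mul hc2sq hδ hδ0.le (by positivity)
    calc c₂ ^ 2 * (2 * δ₀ * ρ₀ ^ 2) = 2 * ρ₀ ^ 2 * (c₂ ^ 2 * δ₀) := by ring
      _ ≤ 2 * ρ₀ ^ 2 * (1 / ρ₀ ^ 2 * d) := mul_le_mul_of_nonneg_left this (by positivity)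
      _ = 1 * (2 * d) := by field_simp
  have hk2 : |4 / 3 * c₃| ≤ 8 / (3 * ρ₀ ^ 2) := by
    rw [abs_mul, abs_of_pos (by norm_num : (0 : ℝ) < 4 / 3)]
    calc 4 / 3 * |c₃| ≤ 4 / 3 * (2 / ρ₀ ^ 2) := mul_le_mul_of_nonneg_left hc3 (by norm_num)
      _ = 8 / (3 * ρ₀ ^ 2) := by ring
  constructor
  · -- the difference
    have hdiff : stepModelK α d c₂ c₃ u x - α * d ^ (α - 1) * c₂ * x =
        α * d ^ (α - 1) * (c₃ * x ^ 2 / 2 + u * (c₂ ^ 2 / (2 * d) - 4 / 3 * c₃)) +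
          (α * (α - 1) * d ^ (α - 2) / 2) * c₂ ^ 2 * x ^ 2 := by
      rw [stepModelK]; ring
    rw [hdiff]
    have e1 : |c₃ * x ^ 2 / 2 + u * (c₂ ^ 2 / (2 * d) - 4 / 3 * c₃)| ≤
        1 / ρ₀ ^ 2 * x ^ 2 + u * (1 / (2 * δ₀ * ρ₀ ^ 2) + 8 / (3 * ρ₀ ^ 2)) := by
      have a1 : |c₃ * x ^ 2 / 2| ≤ 1 / ρ₀ ^ 2 * x ^ 2 := by
        rw [abs_div, abs_mul, abs_of_nonneg (sq_nonneg x), abs_two]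
        have := mul_le_mul_of_nonneg_right hc3 (sq_nonneg x)
        have e : 2 / ρ₀ ^ 2 * x ^ 2 / 2 = 1 / ρ₀ ^ 2 * x ^ 2 := by ring
        linarith only [this, e]
      have a2 : |u * (c₂ ^ 2 / (2 * d) - 4 / 3 * c₃)| ≤ u * (1 / (2 * δ₀ * ρ₀ ^ 2) + 8 / (3 * ρ₀ ^ 2)) := by
        rw [abs_mul, abs_of_nonneg hu0]
        exact mul_le_mul_of_nonneg_left ((abs_sub _ _).trans (add_le_add hk1 hk2)) hu0
      exact (abs_add_le _ _).trans (add_le_add a1 a2)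
    have f1 : |α * d ^ (α - 1) * (c₃ * x ^ 2 / 2 + u * (c₂ ^ 2 / (2 * d) - 4 / 3 * c₃))| ≤
        P * (1 / ρ₀ ^ 2 * x ^ 2 + u * (1 / (2 * δ₀ * ρ₀ ^ 2) + 8 / (3 * ρ₀ ^ 2))) := by
      rw [abs_mul, abs_of_nonneg hp10]
      exact mul_le_mul hp1 e1 (abs_nonneg _) hP0
    have f2 : |α * (α - 1) * d ^ (α - 2) / 2 * c₂ ^ 2 * x ^ 2| ≤ Q * (1 / ρ₀ ^ 2 * x ^ 2) := by
      rw [abs_mul, abs_mul, abs_of_nonneg (sq_nonneg x), abs_of_nonneg (sq_nonneg c₂)]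
      have h1 : |α * (α - 1) * d ^ (α - 2) / 2| = |α * (α - 1)| * d ^ (α - 2) / 2 := by
        rw [abs_div, abs_mul, abs_of_nonneg (Real.rpow_nonneg hd0.le _), abs_two]
      rw [h1, mul_assoc]
      exact mul_le_mul hp2 (mul_le_mul_of_nonneg_right hc2sq (sq_nonneg x)) (by positivity) hQ0
    have hx2 : 0 ≤ x ^ 2 := sq_nonneg x
    have hcoef : 0 ≤ 1 / (2 * δ₀ * ρ₀ ^ 2) + 8 / (3 * ρ₀ ^ 2) := by positivity
    have hρi : (0 : ℝ) ≤ 1 / ρ₀ ^ 2 := by positivity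
    have i1 : 1 / ρ₀ ^ 2 * x ^ 2 + u * (1 / (2 * δ₀ * ρ₀ ^ 2) + 8 / (3 * ρ₀ ^ 2)) ≤
        (1 / ρ₀ ^ 2 + (1 / (2 * δ₀ * ρ₀ ^ 2) + 8 / (3 * ρ₀ ^ 2))) * (x ^ 2 + u) := by
      have e : (1 / ρ₀ ^ 2 + (1 / (2 * δ₀ * ρ₀ ^ 2) + 8 / (3 * ρ₀ ^ 2))) * (x ^ 2 + u) -
          (1 / ρ₀ ^ 2 * x ^ 2 + u * (1 / (2 * δ₀ * ρ₀ ^ 2) + 8 / (3 * ρ₀ ^ 2))) =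
          1 / ρ₀ ^ 2 * u + (1 / (2 * δ₀ * ρ₀ ^ 2) + 8 / (3 * ρ₀ ^ 2)) * x ^ 2 := by ring
      have := add_nonneg (mul_nonneg hρi hu0) (mul_nonneg hcoef hx2)
      linarith only [e, this]
    have i2 : 1 / ρ₀ ^ 2 * x ^ 2 ≤ 1 / ρ₀ ^ 2 * (x ^ 2 + u) :=
      mul_le_mul_of_nonneg_left (le_add_of_nonneg_right hu0) hρi
    calc _ ≤ P * (1 / ρ₀ ^ 2 * x ^ 2 + u * (1 / (2 * δ₀ * ρ₀ ^ 2) + 8 / (3 * ρ₀ ^ 2))) + Q * (1 / ρ₀ ^ 2 * x ^ 2) :=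
          (abs_add_le _ _).trans (add_le_add f1 f2)
      _ ≤ P * ((1 / ρ₀ ^ 2 + (1 / (2 * δ₀ * ρ₀ ^ 2) + 8 / (3 * ρ₀ ^ 2))) * (x ^ 2 + u)) +
            Q * (1 / ρ₀ ^ 2 * (x ^ 2 + u)) :=
          add_le_add (mul_le_mul_of_nonneg_left i1 hP0) (mul_le_mul_of_nonneg_left i2 hQ0)
      _ = _ := by rw [hP, hQ]; ring
  · rw [abs_mul, abs_of_nonneg hp10, modelKA1]
    calc α * d ^ (α - 1) * |c₂| ≤ P * (1 / ρ₀) := mul_le_mul hp1 hc2 hc20 hP0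
      _ = _ := by rw [hP]

end Model

/-! ### The product expansion -/

section Product

/-- **The product expansion (sub-step T2b).** Real-variable form: for exponents `α > 0`, `λ ≥ 0`, class
constants `δ₀, ρ₀ > 0` and one-step constants `K₁, K₂ ≥ 0` there is `K ≥ 0` such that on the controlled
class (`δ₀ ≤ d ≤ 1`, `|c₂| ≤ 1/ρ₀`, `|c₃| ≤ 2/ρ₀²`), for `|x| ≤ 1`, `u ≤ 1`, `Ŷ′ ∈ [0, 1]`, `|m| ≤ M_m`, if
`|ΔW̃ − imageDriverModel d c₂ u x| ≤ K₁ r` and `|Ŷ′ − d^α − (stepModelK α d c₂ c₃ u x − λ u m d^α)| ≤ K₂ r`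
with `u², |x|³, u|x| ≤ r`, then

  `|ΔW̃ · Ŷ′ − 6α d^α c₂ u − imageDriverModel (d · d^α) (d^α c₂ (1 + 2α)) u x| ≤ K · r`:

the product of the models is `d^α(d x + c₂x²/2 − 3c₂u) + α d^α c₂ x² + O(r)` (the `x²` cross term
`d · α d^{α−1} c₂ · x²` is the one-step covariation `d⟨W̃, Y⟩ = Y α κ h″ dt` of [LSW] §5).
[cite: LawlerSchrammWerner2003Restriction, §5 (5.1)–(5.3) and Prop. 5.3] -/
theorem exists_abs_prod_sub_model_le {α lam δ₀ ρ₀ K₁ K₂ : ℝ} (hα : 0 < α) (hlam : 0 ≤ lam) (hδ0 : 0 < δ₀)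
    (hρ₀ : 0 < ρ₀) (hK₁ : 0 ≤ K₁) (hK₂ : 0 ≤ K₂) :
    ∃ K : ℝ, 0 ≤ K ∧ ∀ {d c₂ c₃ m x ZM Yh r : ℝ} {u : ℝ≥0}, δ₀ ≤ d → d ≤ 1 →
      |c₂| ≤ 1 / ρ₀ → |c₃| ≤ 2 / ρ₀ ^ 2 → |m| ≤ massBound δ₀ ρ₀ → |x| ≤ 1 → (u : ℝ) ≤ 1 → 0 ≤ Yh → Yh ≤ 1 →
      (u : ℝ) ^ 2 ≤ r → |x| ^ 3 ≤ r → u * |x| ≤ r →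
      |ZM - imageDriverModel d c₂ u x| ≤ K₁ * r →
      |Yh - d ^ α - (stepModelK α d c₂ c₃ u x - lam * u * m * d ^ α)| ≤ K₂ * r →
      |ZM * Yh - 6 * α * d ^ α * c₂ * u - imageDriverModel (d * d ^ α) (d ^ α * c₂ * (1 + 2 * α)) u x| ≤ K * r := by
  obtain ⟨KQ, hKQ0, hKQ⟩ := exists_abs_stepModelK_sub_linear_le hα hδ0 hρ₀
  have hKA0 := (modelKA_nonneg hα.le hδ0 hρ₀).1
  have hMB0 : 0 ≤ massBound δ₀ ρ₀ := by rw [massBound]; positivity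
  refine ⟨K₁ + (1 + 7 / (2 * ρ₀)) * K₂ + (2 + 7 / ρ₀) * (KQ + lam * massBound δ₀ ρ₀) + 7 / (2 * ρ₀) * modelKA1 α δ₀ ρ₀,
    by positivity, ?_⟩
  intro d c₂ c₃ m x ZM Yh r u hδ hd1 hc2 hc3 hm hx1 hu1 hY0 hY1 hr2 hr3 hrx hM hY
  have hd0 : 0 < d := hδ0.trans_le hδ
  have hu0 : (0 : ℝ) ≤ u := u.coe_nonneg
  have hx0 : 0 ≤ |x| := abs_nonneg _
  have hr0 : 0 ≤ r := le_trans (by positivity) hr2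
  obtain ⟨hQ, ha₁⟩ := hKQ (u := u) x hδ hd1 hc2 hc3
  set y₀ : ℝ := d ^ α with hy₀
  have hy00 : 0 ≤ y₀ := Real.rpow_nonneg hd0.le _
  have hy01 : y₀ ≤ 1 := Real.rpow_le_one hd0.le hd1 hα.le
  set a₁ : ℝ := α * d ^ (α - 1) * c₂ with ha₁def
  have hda : d * a₁ = α * y₀ * c₂ := by
    rw [ha₁def, hy₀, Real.rpow_sub_one hd0.ne']; field_simp
  set PM : ℝ := imageDriverModel d c₂ u x with hPM
  set PY : ℝ := stepModelK α d c₂ c₃ u x - lam * u * m * y₀ with hPY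
  set EM : ℝ := ZM - PM with hEM
  set EY : ℝ := Yh - y₀ - PY with hEY
  set QM : ℝ := c₂ * x ^ 2 / 2 - 3 * c₂ * u with hQM
  set QY : ℝ := PY - a₁ * x with hQY
  have hPMeq : PM = d * x + QM := by rw [hPM, hQM, imageDriverModel]; ring
  -- the algebraic identity
  have key : ZM * Yh - 6 * α * y₀ * c₂ * u - imageDriverModel (d * y₀) (y₀ * c₂ * (1 + 2 * α)) u x =
      EM * Yh + PM * EY + d * x * QY + QM * (a₁ * x + QY) := by
    rw [hEM, hEY, hQY, hPMeq, imageDriverModel]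
    linear_combination (x ^ 2) * hda
  rw [key]
  -- the sizes of the pieces
  set KQ' : ℝ := KQ + lam * massBound δ₀ ρ₀ with hKQ'
  have hKQ'0 : 0 ≤ KQ' := by positivity
  have hx2 : x ^ 2 = |x| ^ 2 := (sq_abs x).symm
  have hx3 : |x| * x ^ 2 = |x| ^ 3 := by rw [hx2]; ring
  have hx21 : x ^ 2 ≤ |x| := by
    rw [hx2, sq]; exact (mul_le_mul_of_nonneg_right hx1 hx0).trans_eq (one_mul _)
  have hQYb : |QY| ≤ KQ' * (x ^ 2 + u) := by
    have h1 : QY = (stepModelK α d c₂ c₃ u x - a₁ * x) - lam * u * m * y₀ := by rw [hQY, hPY]; ring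
    rw [h1]
    have h2 : |lam * u * m * y₀| ≤ lam * massBound δ₀ ρ₀ * (x ^ 2 + u) := by
      rw [abs_mul, abs_mul, abs_mul, abs_of_nonneg hlam, abs_of_nonneg hu0, abs_of_nonneg hy00]
      calc lam * u * |m| * y₀ ≤ lam * u * massBound δ₀ ρ₀ * 1 :=
            mul_le_mul (mul_le_mul_of_nonneg_left hm (by positivity)) hy01 hy00 (by positivity)
        _ = lam * massBound δ₀ ρ₀ * u := by ring
        _ ≤ lam * massBound δ₀ ρ₀ * (x ^ 2 + u) :=
            mul_le_mul_of_nonneg_left (le_add_of_nonneg_left (sq_nonneg x)) (by positivity)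
    calc _ ≤ |stepModelK α d c₂ c₃ u x - a₁ * x| + |lam * u * m * y₀| := abs_sub _ _
      _ ≤ KQ * (x ^ 2 + u) + lam * massBound δ₀ ρ₀ * (x ^ 2 + u) := add_le_add hQ h2
      _ = KQ' * (x ^ 2 + u) := by rw [hKQ']; ring
  have hQMb : |QM| ≤ 1 / ρ₀ * (x ^ 2 / 2 + 3 * u) := by
    rw [hQM]
    have a1 : |c₂ * x ^ 2 / 2| ≤ 1 / ρ₀ * (x ^ 2 / 2) := by
      rw [abs_div, abs_mul, abs_of_nonneg (sq_nonneg x), abs_two]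
      have := mul_le_mul_of_nonneg_right hc2 (sq_nonneg x)
      have e : 1 / ρ₀ * x ^ 2 / 2 = 1 / ρ₀ * (x ^ 2 / 2) := by ring
      linarith only [this, e]
    have a2 : |3 * c₂ * u| ≤ 1 / ρ₀ * (3 * u) := by
      rw [abs_mul, abs_mul, abs_of_nonneg hu0, show |(3 : ℝ)| = 3 by norm_num]
      have := mul_le_mul_of_nonneg_right hc2 hu0
      have e : 3 * (1 / ρ₀ * u) = 1 / ρ₀ * (3 * u) := by ring
      linarith only [this, e]
    calc _ ≤ |c₂ * x ^ 2 / 2| + |3 * c₂ * u| := abs_sub _ _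
      _ ≤ _ := by linarith
  have hPMb : |PM| ≤ 1 + 7 / (2 * ρ₀) := by
    rw [hPMeq]
    have a1 : |d * x| ≤ 1 := by
      rw [abs_mul, abs_of_pos hd0]; exact mul_le_one₀ hd1 hx0 hx1
    have a2 : |QM| ≤ 7 / (2 * ρ₀) := by
      refine hQMb.trans ?_
      have : x ^ 2 / 2 + 3 * u ≤ 7 / 2 := by linarith only [hx21, hx1, hu1]
      calc 1 / ρ₀ * (x ^ 2 / 2 + 3 * u) ≤ 1 / ρ₀ * (7 / 2) := mul_le_mul_of_nonneg_left this (by positivity)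
        _ = 7 / (2 * ρ₀) := by ring
    calc _ ≤ |d * x| + |QM| := abs_add_le _ _
      _ ≤ _ := add_le_add a1 a2
  -- the four products
  have t1 : |EM * Yh| ≤ K₁ * r := by
    rw [abs_mul, abs_of_nonneg hY0]
    have hK₁r : 0 ≤ K₁ * r := (abs_nonneg _).trans hM
    calc |EM| * Yh ≤ K₁ * r * 1 := mul_le_mul hM hY1 hY0 hK₁r
      _ = K₁ * r := mul_one _
  have t2 : |PM * EY| ≤ (1 + 7 / (2 * ρ₀)) * K₂ * r := by
    rw [abs_mul, mul_assoc]
    exact mul_le_mul hPMb hY (abs_nonneg _) (by positivity)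
  have t3 : |d * x * QY| ≤ 2 * KQ' * r := by
    rw [abs_mul, abs_mul, abs_of_pos hd0]
    have h1 : d * |x| ≤ |x| := mul_le_of_le_one_left hx0 hd1
    calc d * |x| * |QY| ≤ |x| * (KQ' * (x ^ 2 + u)) := mul_le_mul h1 hQYb (abs_nonneg _) hx0
      _ = KQ' * (|x| * x ^ 2 + u * |x|) := by ring
      _ = KQ' * (|x| ^ 3 + u * |x|) := by rw [hx3]
      _ ≤ KQ' * (r + r) := mul_le_mul_of_nonneg_left (add_le_add hr3 hrx) hKQ'0
      _ = 2 * KQ' * r := by ring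
  have t4 : |QM * (a₁ * x + QY)| ≤ (7 / (2 * ρ₀) * modelKA1 α δ₀ ρ₀ + 7 / ρ₀ * KQ') * r := by
    rw [abs_mul]
    have hsum : |a₁ * x + QY| ≤ modelKA1 α δ₀ ρ₀ * |x| + KQ' * (x ^ 2 + u) := by
      calc _ ≤ |a₁ * x| + |QY| := abs_add_le _ _
        _ ≤ _ := by rw [abs_mul]; exact add_le_add (mul_le_mul_of_nonneg_right ha₁ hx0) hQYb
    have h0 : 0 ≤ modelKA1 α δ₀ ρ₀ * |x| + KQ' * (x ^ 2 + u) := by positivity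
    calc |QM| * |a₁ * x + QY| ≤ (1 / ρ₀ * (x ^ 2 / 2 + 3 * u)) * (modelKA1 α δ₀ ρ₀ * |x| + KQ' * (x ^ 2 + u)) :=
          mul_le_mul hQMb hsum (abs_nonneg _) (by positivity)
      _ = 1 / ρ₀ * (modelKA1 α δ₀ ρ₀ * (|x| * x ^ 2 / 2 + 3 * (u * |x|)) +
            KQ' * (x ^ 2 * x ^ 2 / 2 + (7 / 2) * (u * x ^ 2) + 3 * u ^ 2)) := by ring
      _ ≤ 1 / ρ₀ * (modelKA1 α δ₀ ρ₀ * (7 / 2 * r) + KQ' * (7 * r)) := by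
          apply mul_le_mul_of_nonneg_left _ (by positivity)
          have b1 : |x| * x ^ 2 / 2 + 3 * (u * |x|) ≤ 7 / 2 * r := by rw [hx3]; linarith only [hr3, hrx, hr0]
          have b2 : x ^ 2 * x ^ 2 / 2 + (7 / 2) * (u * x ^ 2) + 3 * u ^ 2 ≤ 7 * r := by
            have c1 : x ^ 2 * x ^ 2 ≤ |x| ^ 3 := by
              rw [hx2]
              calc |x| ^ 2 * |x| ^ 2 = |x| ^ 3 * |x| := by ring
                _ ≤ |x| ^ 3 * 1 := mul_le_mul_of_nonneg_left hx1 (pow_nonneg hx0 3)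
                _ = |x| ^ 3 := mul_one _
            have c2 : (u : ℝ) * x ^ 2 ≤ u * |x| := mul_le_mul_of_nonneg_left hx21 hu0
            linarith only [c1, c2, hr2, hr3, hrx]
          exact add_le_add (mul_le_mul_of_nonneg_left b1 hKA0) (mul_le_mul_of_nonneg_left b2 hKQ'0)
      _ = _ := by ring
  have hsplit := abs_add_three (EM * Yh + PM * EY) (d * x * QY) (QM * (a₁ * x + QY))
  have hsplit2 := abs_add_le (EM * Yh) (PM * EY)
  have htot : K₁ * r + (1 + 7 / (2 * ρ₀)) * K₂ * r + 2 * KQ' * r + (7 / (2 * ρ₀) * modelKA1 α δ₀ ρ₀ + 7 / ρ₀ * KQ') * r =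
      (K₁ + (1 + 7 / (2 * ρ₀)) * K₂ + (2 + 7 / ρ₀) * (KQ + lam * massBound δ₀ ρ₀) + 7 / (2 * ρ₀) * modelKA1 α δ₀ ρ₀) * r := by
    rw [hKQ']; ring
  linarith

end Product

section Registered

/-- **Registered form** (explicit binders) of `exists_abs_stepModelK_sub_linear_le`: the model of `ΔY`
minus its linear part is `O(x² + u)`, uniformly on the controlled class. [folklore] -/
theorem exists_abs_stepModelK_sub_linear_le_registered :
    ∀ (α δ₀ ρ₀ : ℝ), 0 < α → 0 < δ₀ → 0 < ρ₀ →
      ∃ KQ : ℝ, 0 ≤ KQ ∧ ∀ (d c₂ c₃ : ℝ) (u : ℝ≥0) (x : ℝ), δ₀ ≤ d → d ≤ 1 → |c₂| ≤ 1 / ρ₀ →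
        |c₃| ≤ 2 / ρ₀ ^ 2 → |stepModelK α d c₂ c₃ u x - α * d ^ (α - 1) * c₂ * x| ≤ KQ * (x ^ 2 + u) := by
  intro α δ₀ ρ₀ hα hδ0 hρ₀
  obtain ⟨KQ, hKQ0, hKQ⟩ := exists_abs_stepModelK_sub_linear_le hα hδ0 hρ₀
  exact ⟨KQ, hKQ0, fun d c₂ c₃ u x hδ hd1 hc2 hc3 ↦ (hKQ (u := u) x hδ hd1 hc2 hc3).1⟩

end Registered

end Summit.CriticalPhenomena.SAWScalingLimit.Theorems.SubseqIdentification.BoundaryAreaLaw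

end
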